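import Summits.Ventures.PercRepro.C041SeedCoverBase
import Summits.Ventures.PercRepro.C041StarBoundsTwo
import Summits.Ventures.PercRepro.C041StarBoundsThree
import Summits.Ventures.PercRepro.C041StarBoundsFour
import Summits.Ventures.PercRepro.C041StarBoundsTiny
import Summits.Ventures.PercRepro.C041SeedSlab411
import Summits.Ventures.PercRepro.C041SeedSlab412
import Summits.Ventures.PercRepro.C041SeedSlab413

/-!
# THE TINY-LEAF REGION `B ≥ 1/2` OF THE LAST SEED (mine-3, gen 65; C-041.md §21 (az))

Every star with `B = ∏ (1 - a i) ≥ 1/2` has `A ≤ 9/100` and `P₁ ≤ 1.4143` (from `4AB ≤ (1 - A - B)²`, `A + B ≤ 1`,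
`P₁² B ≤ 1`); with `B ≥ 3/4` even `A ≤ 0.018`, `P₁ ≤ 1.1548`.  The cap-safe slab theorems `InCone_thetaTri_v1_slab411`
(`B ∈ [1/2, 3/4]`, `P₁ ∈ [1, 6/5]`, cap `4`), `…slab412` (`B ∈ [1/2, 3/4]`, `P₁ ∈ [6/5, 1.4143]`, cap `4`) and
`…slab413` (`B ∈ [3/4, 1]`, `P₁ ∈ [1, 1.1548]`, cap `5`) — whose hypotheses are the cap-safe star bounds
`1 + A² ≤ P₁`, `1 + B² ≤ P₂`, `4A ≤ P₁`, `4B ≤ P₂`, `3/2 (1 - A)² ≤ P₁ (P₂ - 1)`, `P₁² B ≤ 1`, `P₂² A ≤ 1`, the `R₂`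
bounds and the new `(1 + A)² ≤ P₁`, `(1 + B)² ≤ P₂` — are assembled by a case split on `B` and `P₁`; where a star
sits above a slab's cap its `P₂` is lowered to the cap (`lower_hyps_capsafe`, the monotonicity of `C041SeedMonotone`).
-/

namespace PercRepro

namespace RelaxedTriangle

open TreeClosure

/-- Lowering `P₂` to `min P₂ c` keeps the cap-safe lower star bounds when the cap `c` satisfies them, and keeps
`P₂² A ≤ 1`. -/
theorem lower_hyps_capsafe (P1 P2 A B c : ℝ) (hA0 : 0 ≤ A) (hc0 : 0 ≤ c)
    (h2 : 1 + B ^ 2 ≤ P2) (h4B : 4 * B ≤ P2) (hR : 3 / 2 * (1 - A) ^ 2 ≤ P1 * (P2 - 1)) (hS2 : (1 + B) ^ 2 ≤ P2)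
    (hu2 : P2 ^ 2 * A ≤ 1)
    (c2 : 1 + B ^ 2 ≤ c) (c4B : 4 * B ≤ c) (cR : 3 / 2 * (1 - A) ^ 2 ≤ P1 * (c - 1)) (cS2 : (1 + B) ^ 2 ≤ c) :
    1 + B ^ 2 ≤ min P2 c ∧ 4 * B ≤ min P2 c ∧ 3 / 2 * (1 - A) ^ 2 ≤ P1 * (min P2 c - 1)
      ∧ (1 + B) ^ 2 ≤ min P2 c ∧ (min P2 c) ^ 2 * A ≤ 1 := by
  rcases le_total P2 c with h | h
  · rw [min_eq_left h]
    exact ⟨h2, h4B, hR, hS2, hu2⟩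
  · rw [min_eq_right h]
    refine ⟨c2, c4B, cR, cS2, ?_⟩
    have hsq : c ^ 2 ≤ P2 ^ 2 := by nlinarith
    nlinarith [mul_le_mul_of_nonneg_right hsq hA0]

/-- Every cap `c ≥ 4` satisfies the cap-safe lower star bounds on `A ∈ [0, 1]`, `B ∈ [0, 1]`, `P₁ ≥ 1`. -/
theorem tinyB_cap_facts (P1 A B c : ℝ) (hc : (4 : ℝ) ≤ c) (hA0 : 0 ≤ A) (hA1 : A ≤ 1) (hB0 : 0 ≤ B) (hB1 : B ≤ 1)
    (hP1a : (1 : ℝ) ≤ P1) :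
    1 + B ^ 2 ≤ c ∧ 4 * B ≤ c ∧ 3 / 2 * (1 - A) ^ 2 ≤ P1 * (c - 1) ∧ (1 + B) ^ 2 ≤ c := by
  have hAq : (1 - A) ^ 2 ≤ 1 := by nlinarith [mul_nonneg hA0 (sub_nonneg.2 hA1)]
  refine ⟨?_, ?_, ?_, ?_⟩
  · nlinarith [mul_nonneg hB0 (sub_nonneg.2 hB1)]
  · linarith
  · nlinarith [hAq, hP1a, hc]
  · nlinarith [mul_nonneg hB0 (sub_nonneg.2 hB1)]

/-- `B ≥ 1/2` forces `A ≤ 9/100` (from `2A ≤ 4AB ≤ (1 - A - B)² ≤ (1/2 - A)²`). -/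
theorem tinyB_A_le (A B : ℝ) (hA0 : 0 ≤ A) (hB : (1 / 2 : ℝ) ≤ B) (hAB1 : A + B ≤ 1)
    (hR2 : 4 * (A * B) ≤ (1 - A - B) ^ 2) : A ≤ (9 / 100 : ℝ) := by
  have hAB0 : 0 ≤ 1 - A - B := by linarith
  have hABle : 1 - A - B ≤ 1 / 2 - A := by linarith
  have hq : (1 - A - B) ^ 2 ≤ (1 / 2 - A) ^ 2 := pow_le_pow_left₀ hAB0 hABle 2
  have h2A : 2 * A ≤ (1 / 2 - A) ^ 2 := by nlinarith [mul_le_mul_of_nonneg_left hB hA0]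
  by_contra hcon
  have hcon' : (9 / 100 : ℝ) < A := not_le.mp hcon
  nlinarith [mul_pos (sub_pos.2 hcon') (show (0 : ℝ) < 2914 / 1000 - A by linarith)]

/-- `B ≥ 3/4` forces `A ≤ 0.018`. -/
theorem tinyB_A_le' (A B : ℝ) (hA0 : 0 ≤ A) (hB : (3 / 4 : ℝ) ≤ B) (hAB1 : A + B ≤ 1)
    (hR2 : 4 * (A * B) ≤ (1 - A - B) ^ 2) : A ≤ (9 / 500 : ℝ) := by
  have hAB0 : 0 ≤ 1 - A - B := by linarith
  have hABle : 1 - A - B ≤ 1 / 4 - A := by linarith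
  have hq : (1 - A - B) ^ 2 ≤ (1 / 4 - A) ^ 2 := pow_le_pow_left₀ hAB0 hABle 2
  have h3A : 3 * A ≤ (1 / 4 - A) ^ 2 := by nlinarith [mul_le_mul_of_nonneg_left hB hA0]
  by_contra hcon
  have hcon' : (9 / 500 : ℝ) < A := not_le.mp hcon
  nlinarith [mul_pos (sub_pos.2 hcon') (show (0 : ℝ) < 3482 / 1000 - A by linarith)]

/-- `P₁² B ≤ 1` and `B ≥ 1/2` force `P₁ ≤ 1.4143`. -/
theorem tinyB_P1_le (P1 B : ℝ) (hB : (1 / 2 : ℝ) ≤ B) (hu1 : P1 ^ 2 * B ≤ 1) :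
    P1 ≤ (14143 / 10000 : ℝ) := by
  have hsq : P1 ^ 2 ≤ 2 := by nlinarith [mul_le_mul_of_nonneg_left hB (sq_nonneg P1)]
  by_contra hcon
  have hcon' : (14143 / 10000 : ℝ) < P1 := not_le.mp hcon
  have : (14143 / 10000 : ℝ) ^ 2 < P1 ^ 2 := by gcongr
  norm_num at this
  linarith

/-- `P₁² B ≤ 1` and `B ≥ 3/4` force `P₁ ≤ 1.1548`. -/
theorem tinyB_P1_le' (P1 B : ℝ) (hB : (3 / 4 : ℝ) ≤ B) (hu1 : P1 ^ 2 * B ≤ 1) :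
    P1 ≤ (2887 / 2500 : ℝ) := by
  have hsq : P1 ^ 2 ≤ 4 / 3 := by nlinarith [mul_le_mul_of_nonneg_left hB (sq_nonneg P1)]
  by_contra hcon
  have hcon' : (2887 / 2500 : ℝ) < P1 := not_le.mp hcon
  have : (2887 / 2500 : ℝ) ^ 2 < P1 ^ 2 := by gcongr
  norm_num at this
  linarith

/-- The last seed on the tiny-leaf region `B ≥ 1/2`: `θ_△(v 1, V a) ∈ cone` for every star with `∏ (1 - a i) ≥ 1/2`. -/
theorem InCone_thetaTri_v1_V_tinyB {m : ℕ} (a : Fin (m + 2) → ℝ) (ha : ∀ i, 0 ≤ a i ∧ a i ≤ 1)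
    (hB : (1 / 2 : ℝ) ≤ ∏ i, (1 - a i)) : InCone (thetaTri (v 1) (V a)) := by
  obtain ⟨hA00, hA11⟩ := prod_unit_mem a ha
  have h1 := one_add_prod_sq_le a ha
  have h2 := one_add_prod_one_sub_sq_le a ha
  have h4A := four_mul_prod_le_prod_one_add_sq a ha
  have h4B := four_mul_prod_one_sub_le_prod a ha
  have hR := sharp_R a ha
  have hu1 := prod_one_add_sq_sq_mul_prod_one_sub_le_one a ha
  have hu2 := prod_one_add_one_sub_sq_sq_mul_prod_le_one a ha
  have hR2 := four_mul_prod_mul_prod_one_sub_le a ha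
  have hB3 := prod_one_sub_le_sq_one_sub_prod a ha
  have hAB1 := prod_add_prod_one_sub_le_one a ha
  have hS1 := sq_one_add_prod_le_prod_one_add_sq_leaf a ha
  have hS2 := sq_one_add_prod_one_sub_le_prod a ha
  set P1 := ∏ i, (1 + a i ^ 2) with hP1d
  set P2 := ∏ i, (1 + (1 - a i) ^ 2) with hP2d
  set A := ∏ i, a i with hAd
  set B := ∏ i, (1 - a i) with hBd
  have hA0 : (0 : ℝ) ≤ A := hA00
  have hB0 : (0 : ℝ) ≤ B := by linarith
  have hB1 : B ≤ 1 := by linarith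
  have hP1a : (1 : ℝ) ≤ P1 := by nlinarith [sq_nonneg A]
  have hA1 : A ≤ (9 / 100 : ℝ) := tinyB_A_le A B hA0 hB hAB1 hR2
  have hP1b : P1 ≤ (14143 / 10000 : ℝ) := tinyB_P1_le P1 B hB hu1
  rcases le_or_gt B (3 / 4 : ℝ) with hb34 | hb34
  · -- `B ∈ [1/2, 3/4]`: slabs 411 (`P₁ ≤ 6/5`) and 412 (`P₁ ≥ 6/5`), cap `4`
    obtain ⟨c2, c4B, cR, cS2⟩ := tinyB_cap_facts P1 A B 4 le_rfl hA0 hA11 hB0 hB1 hP1a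
    obtain ⟨l2, l4, lR, lS2, lu2⟩ := lower_hyps_capsafe P1 P2 A B 4 hA0 (by norm_num) h2 h4B hR hS2 hu2 c2 c4B cR cS2
    rcases le_or_gt P1 (6 / 5 : ℝ) with hp | hp
    · exact InCone_thetaTri_v1_V_of_le a le_rfl (min_le_left _ _)
        (InCone_thetaTri_v1_slab411 P1 (min P2 4) A B hA0 hA1 hB hb34 hP1a hp (min_le_right _ _) h1 l2 h4A l4 lR hu1 lu2
          hR2 hB3 hAB1 hS1 lS2)
    · exact InCone_thetaTri_v1_V_of_le a le_rfl (min_le_left _ _)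
        (InCone_thetaTri_v1_slab412 P1 (min P2 4) A B hA0 hA1 hB hb34 hp.le hP1b (min_le_right _ _) h1 l2 h4A l4 lR hu1 lu2
          hR2 hB3 hAB1 hS1 lS2)
  · -- `B ∈ [3/4, 1]`: `A ≤ 0.018`, `P₁ ≤ 1.1548`, slab 413, cap `5`
    have hB34 : (3 / 4 : ℝ) ≤ B := hb34.le
    have hA1' : A ≤ (9 / 500 : ℝ) := tinyB_A_le' A B hA0 hB34 hAB1 hR2
    have hP1b' : P1 ≤ (2887 / 2500 : ℝ) := tinyB_P1_le' P1 B hB34 hu1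
    obtain ⟨c2, c4B, cR, cS2⟩ := tinyB_cap_facts P1 A B 5 (by norm_num) hA0 hA11 hB0 hB1 hP1a
    obtain ⟨l2, l4, lR, lS2, lu2⟩ := lower_hyps_capsafe P1 P2 A B 5 hA0 (by norm_num) h2 h4B hR hS2 hu2 c2 c4B cR cS2
    exact InCone_thetaTri_v1_V_of_le a le_rfl (min_le_left _ _)
      (InCone_thetaTri_v1_slab413 P1 (min P2 5) A B hA0 hA1' hB34 hB1 hP1a hP1b' (min_le_right _ _) h1 l2 h4A l4 lR hu1 lu2
        hR2 hB3 hAB1 hS1 lS2)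

end RelaxedTriangle

end PercRepro
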